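import Summits.BirchSwinnertonDyer.BirchSwinnertonDyer.Theorems.ByReductionTypeAtTwoRankOneAtTwoOneDoorLawFirstLayerDefs
import Summits.BirchSwinnertonDyer.BirchSwinnertonDyer.Theorems.ByReductionTypeAtTwoRankOneAtTwoBigImageOddLocalOneDoorSubslicePosDisc
import Summits.BirchSwinnertonDyer.BirchSwinnertonDyer.Theorems.ByReductionTypeAtTwoRankOneAtTwoBigImageOddLocalOneDoorSubsliceNegDisc
import Summits.BirchSwinnertonDyer.BirchSwinnertonDyer.Theorems.ByReductionTypeAtTwoRankOneAtTwoBigImageOddLocalOneDoorEggKappaDictionary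
import HarnessLib

/-!
# Route ByReductionTypeAtTwo, crux `RankOneAtTwoBigImageOddLocal` (stmt-BirchSwinnertonDyer-23715), LINE v8.17 `one_door_analytic`:
# AN-22K ON THE SLICE — at a transposition door, «Heegner point not twice ⟺ the door is open at `q₀`» from the first-layer stub and print

Lead prover seat `bsd-line-fkl-p1` g16 (2026-08-29), `--supports stmt-BirchSwinnertonDyer-23715` (helper).  THEOREMS ONLY; no definition, no named fact
introduced, no `sorry`; conditional by design (the residue R₀ / R₀⁺ and the five printed facts are hypotheses where named).  BSD is not proved by any of this.
The `Δ_W < 0` companion of `Theorems/…OneDoorFirstLayerEggCorollary.lean` (AN-13 on the slice from R₀⁺).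

-an's AN-22K `F1Sign2.TranspositionDoor.TranspositionDoorLawAtTwo` (conjecture-grade; Kolyvagin's `c(1) ≢ 0 (mod 2)` read at the transposition prime) says: on the
transposition locus, at a transposition-admissible door `(d_K, q₀)` and an odd-constant datum, `y_K ∉ 2E(K) + E(K)_tors ⟺ E(ℚ) meets the non-norm coset at q₀`.
On the crux's slice both directions follow from the registered first-layer stub and print:
* (⟸) `transpositionDoorLaw_slice_mpr_of_heegnerNonDivisibilityMinimalDoor`: an OPEN door has a `Sel₂`-trivial twin by route GenusKolyvaginAtTwo's PROVED transposition
  twist law `GenusKolyTransp.transpositionTwistLawAtTwo_holds` (Mazur–Rubin 2010 Cor. 3.4 (i) at `T = {q₀}`); the door is door-admissible, minimal, Heegner and coprime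
  to `N_W`; R₀ gives exponent `0`, i.e. «not twice» (`notTwiceUpToTorsion_of_hasTwoDivisibilityUpToTorsion_zero`) — modulo Gross–Zagier, Kolyvagin, modularity,
  Hoffstein–Luo (for `rank E(ℚ) = 1`);
* (⟹) `transpositionDoorLaw_slice_mp_of_print`: «not twice» is exponent `0` (`hasTwoDivisibilityUpToTorsion_zero_of_notTwiceUpToTorsion`), the door opens itself
  (`twist_entireLFunction_ne_zero_of_hasTwoDivisibilityUpToTorsion_zero`, Gross–Zagier), so the datum is a BOTTOM-RUNG datum and the width seat fkl-p2 g13's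
  `meetsNonNormAt_at_bottomRung_of_print` (U₀ from the five printed facts + the transposition twist law) gives the non-norm bit — NO residue needed;
* `transpositionDoorLaw_slice_of_heegnerNonDivisibilityMinimalDoor` / `…_of_heegnerExponent`: the iff, from R₀ (resp. R₀⁺) + PRINT⁵.
So on the slice AN-22K ⟺ the `Δ_W < 0` face of R₀ modulo print (the other inclusion is `…FirstLayerCone.lean` + `…FirstLayer.lean` §1 through R⁻₀).

References: [MazurRubin2010] Prop. 3.3, Cor. 3.4 (i); [Kramer1981] Prop. 3; [GrossLMS1991] §10, Conj. 1.2; [Zhang2014CJM] Thm. 1.1 (shape); [GrossZagier1986]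
Thm. I.6.3, V.§2; [KrizLi2019] Rem. 1.14.
-/

set_option autoImplicit false
-- the Theorems namespace of this sub repeats the summit name by design (D-0017 nested layout)
set_option linter.dupNamespace false

noncomputable section

open scoped Classical

namespace Summit.BirchSwinnertonDyer.BirchSwinnertonDyer.Theorems.RankOneAtTwoOneDoor

open WeierstrassCurve NumberField Literature.NumberTheory.EllipticCurves Literature.NumberTheory.EllipticCurves.ModularForms
  Summit.BirchSwinnertonDyer.Rank1Residual.F1Sign2
  Summit.BirchSwinnertonDyer.Rank1Residual.F1Sign2.TranspositionDoor
  Summit.BirchSwinnertonDyer.BirchSwinnertonDyer.Theses.ByReductionTypeAtTwo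
open Summit.BirchSwinnertonDyer.BirchSwinnertonDyer.Theorems.GenusKolyTransp (transpositionTwistLawAtTwo_holds)

/-! ### §1 (⟸): an open transposition door has a non-divisible Heegner point, from R₀ -/

/-- **R₀ ⟹ AN-22K (⟸) ON THE SLICE**: for `W` of the slice (globally minimal, non-CM, `ρ_{W,2^n}` onto, odd torsion order, odd Tamagawa product, analytic rank
`1`) with `Δ_W < 0` and `Ш(W)[2] = 0`, an imaginary quadratic `K` with `(d_K, q₀)` transposition-admissible and the door OPEN at `q₀` (`MeetsNonNormAt W q₀`), and an
odd-constant datum: the Heegner point is NOT in `2E(K) + E(K)_tors`.  The open door makes the twin `Sel₂`-trivial (PROVED transposition twist law), the door is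
door-admissible / minimal / Heegner / coprime to `N_W`, and R₀ gives exponent `0`.  CONDITIONAL on R₀ and on Gross–Zagier, Kolyvagin, modularity, Hoffstein–Luo;
BSD is not proved by this. [cite: MazurRubin2010, Cor. 3.4 (i)] [cite: Zhang2014CJM, Thm. 1.1 (shape)] [cite: Kramer1981, Prop. 3] -/
theorem transpositionDoorLaw_slice_mpr_of_heegnerNonDivisibilityMinimalDoor (h : HeegnerNonDivisibilityAtSelmerTrivialMinimalDoorAtTwo)
    (hGZ : ∀ (N : ℕ) [NeZero N] (W : WeierstrassCurve ℚ) (K : Type) [Field K] [NumberField K], gross_zagier N W K)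
    (hKo : ∀ (N : ℕ) [NeZero N] (W : WeierstrassCurve ℚ) (K : Type) [Field K] [NumberField K], kolyvagin N W K)
    (hnf : exists_isNewformOf) (hHL : HoffsteinLuo1997_exists_twist_L_one_ne_zero)
    (W : WeierstrassCurve ℚ) [W.IsElliptic] [W.IsGloballyMinimal] [NeZero (W.conductorNorm ℤ)]
    (hCM : ¬ W.HasCM) (hsurj : ∀ n : ℕ, W.HasSurjectiveModNGaloisRep ((2 ^ n : ℕ) : ℤ)) (hT : Odd W.torsionOrder)
    (hc : Odd W.tamagawaProduct) (hr : W.analyticRank = 1) (hΔ : W.Δ < 0) (hSha : ShaTwoTrivial W)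
    (K : Type) [Field K] [NumberField K] (hK : IsImaginaryQuadratic K) (q₀ : ℕ) [Fact q₀.Prime]
    (htr : TranspAdmissible W (NumberField.discr K) q₀) (hnn : MeetsNonNormAt W q₀)
    (Dt : ModularParametrizationData W (W.conductorNorm ℤ)) (H : HeegnerDatum (W.conductorNorm ℤ) (NumberField.discr K)) (ι : K →+* ℂ)
    (P : (W.baseChange K).toAffine.Point) (hP : WeierstrassCurve.Affine.Point.map ι.toRatAlgHom P = heegnerPointComplex Dt H) (hodd : Odd Dt.c) :
    NotTwiceUpToTorsion W K P := by
  have hT2 : NoRationalTwoTorsion W := noRationalTwoTorsion_of_odd_torsionOrder W hT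
  have hrk : W.mordellWeilRank = 1 := (mordellWeilRank_eq_one_of_analyticRank_eq_one_of_isGloballyMinimal hGZ hKo hnf hHL W hr).1
  have hadm : DoorAdmissible W (NumberField.discr K) := ANg16.doorAdmissible_of_transpAdmissible W htr
  have hmin : transpCount W (NumberField.discr K) + 2 * identCount W (NumberField.discr K) = (if W.Δ < 0 then 1 else 0) :=
    minimal_of_transpAdmissible W htr hΔ
  have hHN : SatisfiesHeegnerHypothesis (W.conductorNorm ℤ) K := satisfiesHeegnerHypothesis_of_doorAdmissible W K hK hadm
  have hcop : Nat.Coprime (NumberField.discr K).natAbs (W.conductorNorm ℤ) := by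
    have h1 := Summit.BirchSwinnertonDyer.BirchSwinnertonDyer.Theorems.GenusKoly.heegner_isCoprime_conductorNorm_discr (W := W) hK hHN
    have h2 := Int.isCoprime_iff_gcd_eq_one.mp h1
    rw [Int.gcd_eq_natAbs, Int.natAbs_natCast] at h2
    exact Nat.Coprime.symm h2
  have hsel : twistSelmerTwoCard W (NumberField.discr K) = 1 :=
    (transpositionTwistLawAtTwo_holds W hΔ hT2 hrk hSha (NumberField.discr K) q₀ htr).1 hnn
  exact notTwiceUpToTorsion_of_hasTwoDivisibilityUpToTorsion_zero W K P
    (h W hCM hsurj hT hc hr hSha K hK hadm hmin hcop hHN hsel Dt H ι P hP hodd)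

/-! ### §2 (⟹): a non-divisible Heegner point opens its transposition door — no residue, print only -/

/-- **AN-22K (⟹) ON THE SLICE IS A THEOREM MODULO PRINT**: for `W` of the slice with `Δ_W < 0`, `K` imaginary quadratic with `(d_K, q₀)` transposition-admissible, and
an odd-constant datum whose Heegner point is NOT in `2E(K) + E(K)_tors`: `E(ℚ)` meets the non-norm coset at `q₀`.  «Not twice» is exponent `0`
(`hasTwoDivisibilityUpToTorsion_zero_of_notTwiceUpToTorsion`), so the door opens itself (`twist_entireLFunction_ne_zero_of_hasTwoDivisibilityUpToTorsion_zero`,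
Gross–Zagier) and the datum is a bottom-rung datum; the width seat fkl-p2 g13's `meetsNonNormAt_at_bottomRung_of_print` (U₀ from Gross–Zagier, Kolyvagin, modularity,
Hoffstein–Luo, Gross 1991 Prop. 3.7 (2) + the PROVED transposition twist law) gives the bit at the door's symbol-`−1` prime `q₀`.  CONDITIONAL on the five printed
facts only; BSD is not proved by this. [cite: GrossLMS1991, §10 and Prop. 3.7 (2)] [cite: Kolyvagin1990, Thm. A] [cite: MazurRubin2010, Cor. 3.4 (i)]
[cite: GrossZagier1986, Thm. I.6.3 and V.§2] -/
theorem transpositionDoorLaw_slice_mp_of_print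
    (hGZ : ∀ (N : ℕ) [NeZero N] (W : WeierstrassCurve ℚ) (K : Type) [Field K] [NumberField K], gross_zagier N W K)
    (hKo : ∀ (N : ℕ) [NeZero N] (W : WeierstrassCurve ℚ) (K : Type) [Field K] [NumberField K], kolyvagin N W K)
    (hnf : exists_isNewformOf) (hHL : HoffsteinLuo1997_exists_twist_L_one_ne_zero)
    (h37 : Literature.NumberTheory.EllipticCurves.GrossLMS1991.prop37_2_frobeniusCongruence)
    (W : WeierstrassCurve ℚ) [W.IsElliptic] [W.IsGloballyMinimal] [NeZero (W.conductorNorm ℤ)]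
    (hCM : ¬ W.HasCM) (hsurj : ∀ n : ℕ, W.HasSurjectiveModNGaloisRep ((2 ^ n : ℕ) : ℤ)) (hT : Odd W.torsionOrder)
    (hc : Odd W.tamagawaProduct) (hr : W.analyticRank = 1) (hΔ : W.Δ < 0)
    (K : Type) [Field K] [NumberField K] (hK : IsImaginaryQuadratic K) (q₀ : ℕ) [Fact q₀.Prime]
    (htr : TranspAdmissible W (NumberField.discr K) q₀)
    (Dt : ModularParametrizationData W (W.conductorNorm ℤ)) (H : HeegnerDatum (W.conductorNorm ℤ) (NumberField.discr K)) (ι : K →+* ℂ)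
    (P : (W.baseChange K).toAffine.Point) (hP : WeierstrassCurve.Affine.Point.map ι.toRatAlgHom P = heegnerPointComplex Dt H) (hodd : Odd Dt.c)
    (hnt : NotTwiceUpToTorsion W K P) : MeetsNonNormAt W q₀ := by
  have hadm : DoorAdmissible W (NumberField.discr K) := ANg16.doorAdmissible_of_transpAdmissible W htr
  have hmin : transpCount W (NumberField.discr K) + 2 * identCount W (NumberField.discr K) = (if W.Δ < 0 then 1 else 0) :=
    minimal_of_transpAdmissible W htr hΔ
  have hHN : SatisfiesHeegnerHypothesis (W.conductorNorm ℤ) K := satisfiesHeegnerHypothesis_of_doorAdmissible W K hK hadm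
  -- exponent `0`; the door opens itself
  have hm0 : HasTwoDivisibilityUpToTorsion W K P 0 := hasTwoDivisibilityUpToTorsion_zero_of_notTwiceUpToTorsion W K P hnt
  have hLt : (W.quadraticTwist (NumberField.discr K : ℚ)).entireLFunction 1 ≠ 0 :=
    twist_entireLFunction_ne_zero_of_hasTwoDivisibilityUpToTorsion_zero hnf W hr K hK (hGZ _ W K) hHN Dt H ι P hP hm0
  -- a globally minimal model of the twist
  have hD0 : (NumberField.discr K : ℚ) ≠ 0 := by exact_mod_cast NumberField.discr_ne_zero K
  haveI hEt : (W.quadraticTwist (NumberField.discr K : ℚ)).IsElliptic := W.isElliptic_quadraticTwist hD0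
  obtain ⟨Cd, hCd⟩ := hasGlobalMinimalModel_rat_holds (W.quadraticTwist (NumberField.discr K : ℚ))
  haveI := hCd
  -- the bottom-rung non-norm bit at the door's transposition prime
  obtain ⟨-, -, -, -, hq₀d, hjac, -, -⟩ := htr
  exact meetsNonNormAt_at_bottomRung_of_print hGZ hKo hnf hHL h37 W hCM hsurj hT hc hr K hK hadm hLt Dt H ι P hP
    (Cd • W.quadraticTwist (NumberField.discr K : ℚ)) Cd rfl hmin hodd hm0 hΔ q₀ hq₀d hjac

/-! ### §3 AN-22K on the slice -/

/-- **R₀ + PRINT⁵ ⟹ AN-22K ON THE SLICE**: for `W` of the slice with `Δ_W < 0` and `Ш(W)[2] = 0`, at every transposition-admissible door `(d_K, q₀)` and every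
odd-constant datum, `y_K ∉ 2E(K) + E(K)_tors ⟺ E(ℚ) meets the non-norm coset at q₀` — the statement of -an's AN-22K `TranspositionDoorLawAtTwo` restricted to the
crux's slice (§1 for `⟸`, §2 for `⟹`).  With `…FirstLayerCone.lean`: on the slice AN-22K, R⁻₀ and the `Δ_W < 0` face of R₀ agree modulo print.  CONDITIONAL by
design; BSD is not proved by this. [cite: MazurRubin2010, Cor. 3.4 (i)] [cite: Zhang2014CJM, Thm. 1.1 (shape)] [cite: GrossLMS1991, §10 and Prop. 3.7 (2)]
[cite: KrizLi2019, Rem. 1.14] -/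
theorem transpositionDoorLaw_slice_of_heegnerNonDivisibilityMinimalDoor (h : HeegnerNonDivisibilityAtSelmerTrivialMinimalDoorAtTwo)
    (hGZ : ∀ (N : ℕ) [NeZero N] (W : WeierstrassCurve ℚ) (K : Type) [Field K] [NumberField K], gross_zagier N W K)
    (hKo : ∀ (N : ℕ) [NeZero N] (W : WeierstrassCurve ℚ) (K : Type) [Field K] [NumberField K], kolyvagin N W K)
    (hnf : exists_isNewformOf) (hHL : HoffsteinLuo1997_exists_twist_L_one_ne_zero)
    (h37 : Literature.NumberTheory.EllipticCurves.GrossLMS1991.prop37_2_frobeniusCongruence)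
    (W : WeierstrassCurve ℚ) [W.IsElliptic] [W.IsGloballyMinimal] [NeZero (W.conductorNorm ℤ)]
    (hCM : ¬ W.HasCM) (hsurj : ∀ n : ℕ, W.HasSurjectiveModNGaloisRep ((2 ^ n : ℕ) : ℤ)) (hT : Odd W.torsionOrder)
    (hc : Odd W.tamagawaProduct) (hr : W.analyticRank = 1) (hΔ : W.Δ < 0) (hSha : ShaTwoTrivial W)
    (K : Type) [Field K] [NumberField K] (hK : IsImaginaryQuadratic K) (q₀ : ℕ) [Fact q₀.Prime]
    (htr : TranspAdmissible W (NumberField.discr K) q₀)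
    (Dt : ModularParametrizationData W (W.conductorNorm ℤ)) (H : HeegnerDatum (W.conductorNorm ℤ) (NumberField.discr K)) (ι : K →+* ℂ)
    (P : (W.baseChange K).toAffine.Point) (hP : WeierstrassCurve.Affine.Point.map ι.toRatAlgHom P = heegnerPointComplex Dt H) (hodd : Odd Dt.c) :
    NotTwiceUpToTorsion W K P ↔ MeetsNonNormAt W q₀ :=
  ⟨transpositionDoorLaw_slice_mp_of_print hGZ hKo hnf hHL h37 W hCM hsurj hT hc hr hΔ K hK q₀ htr Dt H ι P hP hodd,
    fun hnn => transpositionDoorLaw_slice_mpr_of_heegnerNonDivisibilityMinimalDoor h hGZ hKo hnf hHL W hCM hsurj hT hc hr hΔ hSha K hK q₀ htr hnn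
      Dt H ι P hP hodd⟩

/-- **R₀⁺ + PRINT⁵ ⟹ AN-22K ON THE SLICE** (the registered stub `stub_heegnerExponent`'s statement, through its odd-constant face
`heegnerNonDivisibilityMinimalDoor_of_heegnerExponent`).  CONDITIONAL by design; BSD is not proved by this. [cite: MazurRubin2010, Cor. 3.4 (i)]
[cite: Zhang2014CJM, Thm. 1.1 (shape)] -/
theorem transpositionDoorLaw_slice_of_heegnerExponent (h : HeegnerExponentAtSelmerTrivialMinimalDoorAtTwo)
    (hGZ : ∀ (N : ℕ) [NeZero N] (W : WeierstrassCurve ℚ) (K : Type) [Field K] [NumberField K], gross_zagier N W K)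
    (hKo : ∀ (N : ℕ) [NeZero N] (W : WeierstrassCurve ℚ) (K : Type) [Field K] [NumberField K], kolyvagin N W K)
    (hnf : exists_isNewformOf) (hHL : HoffsteinLuo1997_exists_twist_L_one_ne_zero)
    (h37 : Literature.NumberTheory.EllipticCurves.GrossLMS1991.prop37_2_frobeniusCongruence)
    (W : WeierstrassCurve ℚ) [W.IsElliptic] [W.IsGloballyMinimal] [NeZero (W.conductorNorm ℤ)]
    (hCM : ¬ W.HasCM) (hsurj : ∀ n : ℕ, W.HasSurjectiveModNGaloisRep ((2 ^ n : ℕ) : ℤ)) (hT : Odd W.torsionOrder)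
    (hc : Odd W.tamagawaProduct) (hr : W.analyticRank = 1) (hΔ : W.Δ < 0) (hSha : ShaTwoTrivial W)
    (K : Type) [Field K] [NumberField K] (hK : IsImaginaryQuadratic K) (q₀ : ℕ) [Fact q₀.Prime]
    (htr : TranspAdmissible W (NumberField.discr K) q₀)
    (Dt : ModularParametrizationData W (W.conductorNorm ℤ)) (H : HeegnerDatum (W.conductorNorm ℤ) (NumberField.discr K)) (ι : K →+* ℂ)
    (P : (W.baseChange K).toAffine.Point) (hP : WeierstrassCurve.Affine.Point.map ι.toRatAlgHom P = heegnerPointComplex Dt H) (hodd : Odd Dt.c) :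
    NotTwiceUpToTorsion W K P ↔ MeetsNonNormAt W q₀ :=
  transpositionDoorLaw_slice_of_heegnerNonDivisibilityMinimalDoor (heegnerNonDivisibilityMinimalDoor_of_heegnerExponent h) hGZ hKo hnf hHL h37 W hCM hsurj
    hT hc hr hΔ hSha K hK q₀ htr Dt H ι P hP hodd

end Summit.BirchSwinnertonDyer.BirchSwinnertonDyer.Theorems.RankOneAtTwoOneDoor

end
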